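import Literature.AlgebraicGeometry.Resolution.BlowupSequencesComapMarked
import Literature.AlgebraicGeometry.Resolution.KollarBlowupSequenceFunctors
import Mathlib.AlgebraicGeometry.Morphisms.LocalIso
import HarnessLib

/-!
# Multiple blow-ups and resolutions of marked ideals descend along surjective local isomorphisms (Kollár 2007, 3.37 / 3.105, `𝓜 = {open immersions}`)

Topic: `Literature/AlgebraicGeometry/Resolution`. Companion of `KollarGlobalization.lean`
(J. Kollár, *Lectures on Resolution of Singularities*, 2007, Prop. 3.37 and Thm. 3.105: blow-up
sequence functors are glued from local data along `X' := ∐_i U_{x_i} → X`). There the blow-up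
SEQUENCE is descended along a smooth surjection (`CentreSeq.descent`); to conclude that the
descended sequence is again a smooth blow-up sequence of order `m` / a resolution of the marked
ideal `(X, I, E, m)` one needs that the conditions of BGMW Def. 3.1.3 (regular centres inside the
support, simple normal crossings with the boundary, empty final support) DESCEND from `X'` to `X`.
The tree has the pull-back direction along étale morphisms (`BlowupSequencesComapMarked.lean`:
`IsAdmissibleFor.comap_of_etale`, `IsResolutionOf.comap_of_etale`; `MarkedIdealsEtale.lean`:
`HasSNCWith.comap_of_etale`). This file PROVES the converse along SURJECTIVE LOCAL ISOMORPHISMS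
`g : X' → X` (Mathlib `IsLocalIso`: source-locally an open immersion — the case
`X' = ∐_i U_{x_i}` of Kollár's `𝓜 = {open immersions}`, "the only case we need for the proof of
(3.103)"), where the stalk maps are isomorphisms and everything is transported pointwise:

* `isIso_stalkMap_of_isLocalIso`, `flat_of_isLocalIso`, … — local isomorphisms have invertible
  stalk maps and are flat, unramified, locally of finite type;
* `comap_injective_of_isLocalIso` — pulling back ideal sheaves along a surjective local
  isomorphism is injective;
* `HasSNCWith.of_comap_of_isLocalIso` — **simple normal crossings descend**: a regular system of
  parameters of `𝒪_{X',x'} ≅ 𝒪_{X, g x'}` adapted to `g^*E`, `g^*C` transports back (the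
  boundary components through `g x'` correspond injectively to those of `g^*E` through `x'`, by
  the injectivity above);
* `Scheme.IsRegular.of_isLocalIso_surjective`, `Scheme.IsRegular.of_subscheme_comap_of_isLocalIso`
  — regularity of the target / of a centre `V(C)` descends from `V(g^*C) = V(C) ×_X X'`;
* `CentreSeq.IsAdmissibleFor.of_comap_of_isLocalIso`, `CentreSeq.IsResolutionOf.of_comap_of_isLocalIso`,
  `CentreSeq.NoEmptyCentres.of_comap` — **a blow-up sequence `s` starting with `X` is a multiple
  blow-up / a resolution of `(X, 𝓘, E, μ)` as soon as the induced sequence `g^* s` is one of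
  `g^*(X, 𝓘, E, μ)`** (stage by stage, the comparison morphisms `(g^*s)_i → X_i` being again
  surjective local isomorphisms, `blowup.comapMap_mem`).

## Sources

* J. Kollár, *Lectures on Resolution of Singularities* (2007): Prop. 3.37, Thm. 3.105 (proof).
  [Kollar2007]
* E. Bierstone, D. Grigoriev, P. Milman, J. Włodarczyk, arXiv:1206.3090, Def. 3.1.3, Thm. 8.0.5
  (1)–(2) — the tree's vocabulary. [BierstoneGrigorievMilmanWlodarczyk2011]
-/

noncomputable section

open CategoryTheory CategoryTheory.Limits AlgebraicGeometry TopologicalSpace IsLocalRing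

namespace Literature.AlgebraicGeometry.Resolution

universe u

/-! ## Local isomorphisms: stalks and standard consequences -/

section LocalIso

variable {X' X : Scheme.{u}} (g : X' ⟶ X) [IsLocalIso g]

/-- The stalk maps of a local isomorphism are isomorphisms. [folklore] -/
theorem isIso_stalkMap_of_isLocalIso (x' : X') : IsIso (g.stalkMap x') := by
  obtain ⟨U, hxU, hU⟩ := IsLocalIso.exists_isOpenImmersion (f := g) x'
  have h1 : IsIso ((U.ι ≫ g).stalkMap ⟨x', hxU⟩) := inferInstance
  rw [Scheme.Hom.stalkMap_comp] at h1
  have h2 : IsIso (g.stalkMap x' ≫ U.ι.stalkMap (⟨x', hxU⟩ : U)) := h1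
  have h3 : IsIso (U.ι.stalkMap (⟨x', hxU⟩ : U)) := inferInstance
  exact @IsIso.of_isIso_comp_right _ _ _ _ _ (g.stalkMap x') (U.ι.stalkMap (⟨x', hxU⟩ : U)) h3 h2

/-- A local isomorphism is flat. [folklore] -/
theorem flat_of_isLocalIso : Flat g :=
  (IsLocalIso.le_of_isZariskiLocalAtSource @Flat) _ _ g ‹_›

/-- A local isomorphism is formally unramified. [folklore] -/
theorem formallyUnramified_of_isLocalIso : FormallyUnramified g :=
  (IsLocalIso.le_of_isZariskiLocalAtSource @FormallyUnramified) _ _ g ‹_›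

/-- A local isomorphism is locally of finite type. [folklore] -/
theorem locallyOfFiniteType_of_isLocalIso : LocallyOfFiniteType g :=
  (IsLocalIso.le_of_isZariskiLocalAtSource @LocallyOfFiniteType) _ _ g ‹_›

/-- The stalk map of a local isomorphism as a ring isomorphism `𝒪_{X, g x'} ≃ 𝒪_{X', x'}`.
[folklore] -/
def stalkEquivOfIsLocalIso (x' : X') : X.presheaf.stalk (g x') ≃+* X'.presheaf.stalk x' :=
  haveI := isIso_stalkMap_of_isLocalIso g x'
  (asIso (g.stalkMap x')).commRingCatIsoToRingEquiv

/-- Stalks of pulled-back ideal sheaves along a local isomorphism: `(g^*K)_{x'} = e(K_{g x'})`.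
[folklore] -/
theorem stalkIdeal_comap_of_isLocalIso (K : X.IdealSheafData) (x' : X') :
    stalkIdeal (K.comap g) x' = (stalkIdeal K (g x')).map (stalkEquivOfIsLocalIso g x') :=
  stalkIdeal_comap_eq_map g K x'

/-- … and conversely `K_{g x'} = e⁻¹((g^*K)_{x'})`. [folklore] -/
theorem stalkIdeal_eq_map_symm_of_isLocalIso (K : X.IdealSheafData) (x' : X') :
    stalkIdeal K (g x') = (stalkIdeal (K.comap g) x').map (stalkEquivOfIsLocalIso g x').symm := by
  rw [stalkIdeal_comap_of_isLocalIso, Ideal.map_symm,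
    Ideal.comap_map_of_bijective _ (stalkEquivOfIsLocalIso g x').bijective]

variable [Surjective g]

/-- **Pulling back ideal sheaves along a surjective local isomorphism is injective** (compare
the stalks `K_{g x'} = e⁻¹((g^*K)_{x'})`). [folklore] -/
theorem comap_injective_of_isLocalIso :
    Function.Injective fun K : X.IdealSheafData => K.comap g := by
  intro K₁ K₂ h
  have hst : ∀ x : X, stalkIdeal K₁ x = stalkIdeal K₂ x := fun x => by
    obtain ⟨x', rfl⟩ := g.surjective x
    rw [stalkIdeal_eq_map_symm_of_isLocalIso g K₁, stalkIdeal_eq_map_symm_of_isLocalIso g K₂]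
    exact congrArg (fun K : X'.IdealSheafData => (stalkIdeal K x').map _) h
  exact le_antisymm (le_of_forall_stalkIdeal_le fun x => (hst x).le)
    (le_of_forall_stalkIdeal_le fun x => (hst x).ge)

end LocalIso

section Regular

variable {X' X : Scheme.{u}}

/-- **Regularity descends along surjective local isomorphisms.** [folklore] -/
theorem Scheme.IsRegular.of_isLocalIso_surjective (g : X' ⟶ X) [IsLocalIso g] [Surjective g]
    (h : Scheme.IsRegular X') : Scheme.IsRegular X := by
  intro x
  obtain ⟨x', rfl⟩ := g.surjective x
  haveI := h x'
  exact IsRegularLocalRing.of_ringEquiv (stalkEquivOfIsLocalIso g x').symm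

/-- **Regular centres descend**: if `V(g^*C) = V(C) ×_X X'` is regular then so is `V(C)`
(`V(C) ×_X X' → V(C)` is again a surjective local isomorphism). [folklore] -/
theorem Scheme.IsRegular.of_subscheme_comap_of_isLocalIso (g : X' ⟶ X) [IsLocalIso g] [Surjective g]
    (C : X.IdealSheafData) (h : Scheme.IsRegular (C.comap g).subscheme) :
    Scheme.IsRegular C.subscheme := by
  have h' : Scheme.IsRegular (pullback g C.subschemeι) := h.of_iso (C.comapIso g).hom
  haveI : IsLocalIso (pullback.snd g C.subschemeι) := MorphismProperty.pullback_snd _ _ ‹_›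
  haveI : Surjective (pullback.snd g C.subschemeι) := MorphismProperty.pullback_snd _ _ ‹_›
  exact Scheme.IsRegular.of_isLocalIso_surjective (pullback.snd g C.subschemeι) h'

end Regular

/-! ## Simple normal crossings descend along surjective local isomorphisms -/

section SNC

variable {X' X : Scheme.{u}} (g : X' ⟶ X) [IsLocalIso g] [Surjective g]

/-- **Simple normal crossings descend along surjective local isomorphisms**: if `g^*E` has
simple normal crossings with `g^*C` (`HasSNCWith`, BGMW Def. 3.1.1 / 3.1.3 (2)) then `E` has
simple normal crossings with `C`. A regular system of parameters of `𝒪_{X',x'}` adapted to the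
pulled-back data transports along `𝒪_{X, g x'} ≅ 𝒪_{X',x'}`; the boundary components of `E`
through `g x'` map injectively to those of `g^*E` through `x'` (`comap_injective_of_isLocalIso`).
[folklore] -/
theorem HasSNCWith.of_comap_of_isLocalIso {E : List X.IdealSheafData} {C : X.IdealSheafData}
    (h : HasSNCWith (E.map (·.comap g)) (C.comap g)) : HasSNCWith E C := by
  classical
  intro x
  obtain ⟨x', rfl⟩ := g.surjective x
  obtain ⟨hreg', u', hu', ⟨ι', hι', hι'D⟩, hC'⟩ := h x'
  haveI := hreg'
  set e := stalkEquivOfIsLocalIso g x' with he_def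
  haveI hreg : IsRegularLocalRing (X.presheaf.stalk (g x')) := IsRegularLocalRing.of_ringEquiv e.symm
  refine ⟨hreg, ?_⟩
  -- the embedding dimensions agree
  have hrank : (maximalIdeal (X.presheaf.stalk (g x'))).spanFinrank =
      (maximalIdeal (X'.presheaf.stalk x')).spanFinrank := by
    rw [← map_ringEquiv_maximalIdeal e, Ideal.spanFinrank_map_eq_of_ringEquiv]
  let σ : Fin (maximalIdeal (X.presheaf.stalk (g x'))).spanFinrank ≃
      Fin (maximalIdeal (X'.presheaf.stalk x')).spanFinrank := finCongr hrank
  let u : Fin (maximalIdeal (X.presheaf.stalk (g x'))).spanFinrank → X.presheaf.stalk (g x') :=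
    fun i => e.symm (u' (σ i))
  have huσ : ∀ j, u (σ.symm j) = e.symm (u' j) := fun j => by
    simp only [u, Equiv.apply_symm_apply]
  refine ⟨u, ?_, ?_, ?_⟩
  · -- `(u) = 𝔪_{g x'}`
    have hr : Set.range u = e.symm '' Set.range u' := by
      rw [show u = (fun j => e.symm (u' j)) ∘ σ from rfl, σ.surjective.range_comp]
      exact Set.range_comp _ u'
    rw [hr, ← Ideal.map_span e.symm, hu', map_ringEquiv_maximalIdeal]
  · -- the boundary components through `g x'`
    let θ : {D // D ∈ E ∧ g x' ∈ D.support} → {D' // D' ∈ E.map (·.comap g) ∧ x' ∈ D'.support} :=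
      fun D => ⟨D.1.comap g, List.mem_map.mpr ⟨D.1, D.2.1, rfl⟩, by
        rw [Scheme.IdealSheafData.support_comap]; exact D.2.2⟩
    have hθ : Function.Injective θ := fun D₁ D₂ hD =>
      Subtype.ext (comap_injective_of_isLocalIso g (congrArg Subtype.val hD))
    refine ⟨fun D => σ.symm (ι' (θ D)), fun D₁ D₂ heq => hθ (hι' (σ.symm.injective heq)), ?_⟩
    intro D
    rw [huσ, stalkIdeal_eq_map_symm_of_isLocalIso g, ← he_def,
      show stalkIdeal (D.1.comap g) x' = Ideal.span {u' (ι' (θ D))} from hι'D (θ D), Ideal.map_span,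
      Set.image_singleton]
  · -- the centre
    intro hx
    have hx' : x' ∈ (C.comap g).support := by
      rw [Scheme.IdealSheafData.support_comap]; exact hx
    obtain ⟨S, hS⟩ := hC' hx'
    refine ⟨σ ⁻¹' S, ?_⟩
    rw [stalkIdeal_eq_map_symm_of_isLocalIso g, ← he_def, hS, Ideal.map_span, Set.image_image]
    congr 1
    rw [show u = (fun j => e.symm (u' j)) ∘ σ from rfl, Set.image_comp, σ.image_preimage]

end SNC

/-! ## Multiple blow-ups and resolutions descend -/

namespace CentreSeq

variable {X' X : Scheme.{u}}

/-- A sequence whose induced sequence has no empty blow-ups has none (`g^* ⊤ = ⊤`). [folklore] -/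
theorem NoEmptyCentres.of_comap : ∀ {X X' : Scheme.{u}} {s : CentreSeq X} (g : X' ⟶ X),
    (s.comap g).NoEmptyCentres → s.NoEmptyCentres
  | _, _, nil _, _, _ => trivial
  | _, _, cons C rest, g, h => by
    obtain ⟨hC, hrest⟩ := h
    refine ⟨fun hC' => hC ?_, NoEmptyCentres.of_comap (blowup.comapMap C g) hrest⟩
    rw [hC', Scheme.IdealSheafData.comap_top]

/-- **Multiple blow-ups of marked ideals descend along surjective local isomorphisms** (the
converse of `IsAdmissibleFor.comap_of_etale` in this case): if the induced sequence `g^* s` is a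
multiple blow-up of `g^*(X, 𝓘, E, μ)` (BGMW Def. 3.1.3 (1)–(2)), then `s` is one of
`(X, 𝓘, E, μ)` — centres inside the support (`MarkedIdeal.support_comap_of_etale'`, `g`
surjective), simple normal crossings (`HasSNCWith.of_comap_of_isLocalIso`), regular centres
(`Scheme.IsRegular.of_subscheme_comap_of_isLocalIso`); then recurse along the comparison
morphism `Bl_{g^*C} X' → Bl_C X`, again a surjective local isomorphism (`blowup.comapMap_mem`)
under which the transforms correspond (`MarkedIdeal.transform_comap_of_flat'`).
[cite: Kollar2007, Thm. 3.105 (proof), Prop. 3.37] -/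
theorem IsAdmissibleFor.of_comap_of_isLocalIso : ∀ {X X' : Scheme.{u}} [IsLocallyNoetherian X]
    (s : CentreSeq X) (g : X' ⟶ X) [IsLocalIso g] [Surjective g] (M : MarkedIdeal X),
    (s.comap g).IsAdmissibleFor (M.comap g) → s.IsAdmissibleFor M
  | _, _, _, nil _, _, _, _, _, _ => trivial
  | X, X', _, cons C rest, g, _, _, M, h => by
    haveI : Flat g := flat_of_isLocalIso g
    haveI : FormallyUnramified g := formallyUnramified_of_isLocalIso g
    haveI : LocallyOfFiniteType g := locallyOfFiniteType_of_isLocalIso g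
    haveI : IsLocallyNoetherian X' := LocallyOfFiniteType.isLocallyNoetherian g
    haveI : IsLocallyNoetherian (blowup C) := isLocallyNoetherian_blowup C
    haveI : IsLocallyNoetherian (blowup (C.comap g)) := isLocallyNoetherian_blowup (C.comap g)
    haveI : IsLocalIso (blowup.comapMap C g) := blowup.comapMap_mem @IsLocalIso C g ‹_›
    haveI : Surjective (blowup.comapMap C g) := blowup.comapMap_mem @Surjective C g ‹_›
    haveI : Flat (blowup.comapMap C g) := flat_of_isLocalIso _
    obtain ⟨hsupp, hsnc, hC, hrest⟩ := h
    refine (isAdmissibleFor_cons C rest M).mpr ⟨?_, hsnc.of_comap_of_isLocalIso g,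
      Scheme.IsRegular.of_subscheme_comap_of_isLocalIso g C hC, ?_⟩
    · intro x hx
      obtain ⟨x', rfl⟩ := g.surjective x
      have hx' : x' ∈ ((C.comap g).support : Set X') := by
        rw [Scheme.IdealSheafData.support_comap]; exact hx
      have h2 := hsupp hx'
      rw [MarkedIdeal.support_comap_of_etale'] at h2
      exact h2
    · have e := MarkedIdeal.transform_comap_of_flat' g (s := blowup.comapMap C g)
        (π := blowup.π C) (π' := blowup.π (C.comap g)) (blowup.comapMap_π C g) M C
      change (rest.comap (blowup.comapMap C g)).IsAdmissibleFor
        ((M.comap g).transform (blowup.π (C.comap g)) (C.comap g)) at hrest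
      rw [e] at hrest
      exact IsAdmissibleFor.of_comap_of_isLocalIso rest (blowup.comapMap C g)
        (M.transform (blowup.π C) C) hrest

/-- **Resolutions of marked ideals descend along surjective local isomorphisms**: if `g^* s`
resolves `g^*(X, 𝓘, E, μ)` then `s` resolves `(X, 𝓘, E, μ)` (BGMW Def. 3.1.3 (6): the final
support, pulled back along the surjective comparison morphism `(g^*s)_r → X_r`, is empty).
[cite: Kollar2007, Thm. 3.105 (proof), Prop. 3.37] -/
theorem IsResolutionOf.of_comap_of_isLocalIso [IsLocallyNoetherian X] {s : CentreSeq X}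
    (g : X' ⟶ X) [IsLocalIso g] [Surjective g] {M : MarkedIdeal X}
    (h : (s.comap g).IsResolutionOf (M.comap g)) : s.IsResolutionOf M := by
  haveI : Flat g := flat_of_isLocalIso g
  haveI : FormallyUnramified g := formallyUnramified_of_isLocalIso g
  haveI : LocallyOfFiniteType g := locallyOfFiniteType_of_isLocalIso g
  haveI : IsLocallyNoetherian X' := LocallyOfFiniteType.isLocallyNoetherian g
  refine ⟨IsAdmissibleFor.of_comap_of_isLocalIso s g M h.1, ?_⟩
  haveI : Surjective (s.comapι g) :=
    comapι_mem (@Surjective ⊓ @Flat) (fun _ h => h.2) s g ⟨‹_›, ‹_›⟩ |>.1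
  haveI : FormallyUnramified (s.comapι g) :=
    comapι_mem (@FormallyUnramified ⊓ @Flat) (fun _ h => h.2) s g ⟨‹_›, ‹_›⟩ |>.1
  haveI : LocallyOfFiniteType (s.comapι g) :=
    comapι_mem (@LocallyOfFiniteType ⊓ @Flat) (fun _ h => h.2) s g ⟨‹_›, ‹_›⟩ |>.1
  haveI : Flat (s.comapι g) := flat_comapι s g
  have h2 := h.2
  rw [transformMarked_comap, MarkedIdeal.support_comap_of_etale'] at h2
  refine Set.eq_empty_of_forall_notMem fun y hy => ?_
  obtain ⟨y', rfl⟩ := (s.comapι g).surjective y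
  have hy' : y' ∈ (s.comapι g) ⁻¹' (s.transformMarked M).support := hy
  rw [h2] at hy'
  exact hy'

end CentreSeq

end Literature.AlgebraicGeometry.Resolution

end
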